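import Summits.Schanuel.Schanuel.Theorems.RootDecomp1BMovingZero01

/-!
# RootDecomp1BMovingZero — lens 4, generation 35 «AX-TRANSVERSAL MOVING ZERO» (decomposition node: the (1 | ρ) storey of X below ultra ⟸ IsolatedIntersection ∧ ApproxOfIsolated) — continuation (RootDecomp1BMovingZero02): §3 the endgame `four_le_polarDeg_of_movingZero (hLW) (hX) (hρ : LiouvilleOrder 8 ρ) (hMZ : MovingZeroApprox ρ)`; §4 the cells at (1|ρ) below ultra, At-cells, 1K shapes, members `rhoT = towerNumber 9` / `lambdaH`

(lens-4 g35 `MovingZero.lean` [HOME/decomp-schanuel-lens-4/g35/MovingZero.lean sha256 6d06e993…1960, 629 l + MovingZeroProbe 83779325… + MovingZeroCtrl 5b99b81a… + NODE.md 7a036a2d…; NOTE/CLAIM L1791, ACK + CHECKLIST B-g35 L1797, NODE L1816 / REQUEST L1817]; port by census-1 gen 16 in two parts `RootDecomp1BMovingZero01`–`02` — see the PORT NOTE of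
part 01; `--supports stmt-Schanuel-32406`; rung 0.)
-/

noncomputable section

open Complex Polynomial

namespace Summit.Schanuel.Schanuel.Theorems.RootDecomp1BMovingZero

open Summit.Schanuel.Schanuel.Theorems.RootDecomp1KHyper (LWMeasure exists_int_mvrelation)
open Summit.Schanuel.Schanuel.Theorems.RootDecomp1KHyper.HyperCell (log_sixteen_lt_three HyperLiouville lambdaH hyperLiouville_lambdaH
  ExplicitRatExpApprox C₀rat)
open Summit.Schanuel.Schanuel.Theorems.RootDecomp1KGeneric (LiouvilleOrder)
open Summit.Schanuel.Schanuel.Theorems.RootDecomp1KFiniteOrderCell (towerNumber liouvilleOrder_towerNumber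
  not_hyperLiouville_towerNumber towerNumber_pos liouville_towerNumber)
open Summit.Schanuel.Schanuel.Theorems.RootDecomp1BFedFlagCore (KleinIH polarDeg polarField coe_mem_polarField
  exp_coe_mem_polarField exp_coe_mul_I_mem_polarField coe_mul_I_mem_polarField)
open Summit.Schanuel.Schanuel.Theorems.RootDecomp1BDefectFloorDefs (SharpRelativeLindemannAt TameDefectZeroAt
  WildSharpDefectZeroAt WildSharpDefectZeroInitAt)
open Summit.Schanuel.Schanuel.Theorems.RootDecomp1BDefectFloorCells (natCast_le_trdeg_of_algebraicIndependent)
open Summit.Schanuel.Schanuel.Theorems.RootDecomp1BRadicalDescent (UltraLiouville isAlgebraic_base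
  linearIndependent_base four_le_polarDeg_one_ultra linearIndependent_one_of_irrational)
open Summit.Schanuel.Schanuel.Theorems.RootDecomp1BSRLLogLiouville (algebraicIndependent_option_exp_of_LW)

/-! ## §3  The endgame: `MovingZeroApprox ρ` + `ExplicitRatExpApprox` + exponential order 8 ⟹ `t(1, ρ) ≥ 4` -/

/-- The tree constant `C₀rat r` is non-negative. -/
private theorem C₀rat_nonneg (r : ℚ) : 0 ≤ C₀rat r := by
  unfold C₀rat; positivity

/-- `1 < log 16`. -/
private theorem one_lt_log_sixteen : 1 < Real.log 16 := by
  rw [Real.lt_log_iff_exp_lt (by norm_num)]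
  have h1 := Real.exp_one_lt_d9
  linarith

/-- Exponent bookkeeping for the approximation measure: for `1 ≤ n ≤ Y`, `log 16 ≤ Y`,
`n² Y (log Y + log n)² / (log Y)² ≤ 4 n² Y`. -/
theorem factor_le {n : ℕ} {Y : ℝ} (hn1 : 1 ≤ n) (hnY : (n : ℝ) ≤ Y) (hY : Real.log 16 ≤ Y) :
    (n : ℝ) ^ 2 * Y * (Real.log Y + Real.log n) ^ 2 / Real.log Y ^ 2 ≤ 4 * ((n : ℝ) ^ 2 * Y) := by
  have hY1 : 1 < Y := lt_of_lt_of_le one_lt_log_sixteen hY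
  have hlY : 0 < Real.log Y := Real.log_pos hY1
  have hn1r : (1 : ℝ) ≤ n := by exact_mod_cast hn1
  have hln0 : 0 ≤ Real.log n := Real.log_nonneg hn1r
  have hlnY : Real.log n ≤ Real.log Y := Real.log_le_log (by linarith) hnY
  have hnum : (Real.log Y + Real.log n) ^ 2 ≤ 4 * Real.log Y ^ 2 := by nlinarith
  rw [div_le_iff₀ (by positivity)]
  have hY0 : 0 ≤ Y := by linarith
  have h := mul_le_mul_of_nonneg_left hnum (show 0 ≤ (n : ℝ) ^ 2 * Y by positivity)
  linarith

/-- **THE KERNEL (general polar field).**  For `ρ` of exponential Liouville order `8` with the moving-zero piece,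
every real tuple `r` whose polar field contains `ρ, e, e^i, e^ρ, e^{iρ}` has `t(r) ≥ 4` (mod `hLW`, `hX`).
ORDER BOOKKEEPING (the numeral 8): the measure's exponent is `C₀(1)·n²·Y·(log Y + log n)²/log²Y ≤ 4 C₀(1) n² Y`
(`n ≤ Y`), with `n ≤ c₁q²` and `Y ≤ (c₁ + c₂ + 3) q³` (`log(q+1) ≤ q` — ONE order of slack: keeping
`q² log(q+1)` would give `7`), so the exponent is `≤ K q⁷`, `K = 4 C₀(1) c₁² (c₁ + c₂ + 3)`, against `κ q⁸`
from the order-8 approximant: `κ q⁸ < K q⁷ + |log C|` is absurd for `q > (K + |log C|)/κ`. -/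
theorem four_le_polarDeg_of_movingZero (hLW : LWMeasure) (hX : ExplicitRatExpApprox) {ρ : ℝ}
    (hρ : LiouvilleOrder 8 ρ) (hMZ : MovingZeroApprox ρ) {m : ℕ} {r : Fin m → ℝ}
    (hρr : (ρ : ℂ) ∈ polarField r) (he : cexp 1 ∈ polarField r) (hei : cexp Complex.I ∈ polarField r)
    (heρ : cexp ρ ∈ polarField r) (heρi : cexp (ρ * Complex.I) ∈ polarField r) :
    ((2 + 2 : ℕ) : Cardinal) ≤ polarDeg r := by
  have h3 : AlgebraicIndependent ℚ (triple ρ) := algebraicIndependent_triple hLW (hρ.liouville (by norm_num))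
  by_contra h4
  obtain ⟨halg₁, halg₂⟩ := isAlgebraic_pair_of_lt_four h3 hρr he hei heρ heρi h4
  obtain ⟨C, κ, hC, hκ, c₁, c₂, q₀, hmain⟩ := hMZ h3 halg₁ halg₂
  -- positive majorants of the existential constants
  set c₁' : ℝ := max c₁ 1 with hc₁'
  set c₂' : ℝ := max c₂ 1 with hc₂'
  have hc₁'0 : 0 < c₁' := lt_of_lt_of_le one_pos (le_max_right _ _)
  have hc₂'0 : 0 < c₂' := lt_of_lt_of_le one_pos (le_max_right _ _)
  -- the constant of the clash and the size of the approximant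
  set K : ℝ := 4 * C₀rat 1 * c₁' ^ 2 * (c₁' + c₂' + 3) with hK
  have hC0 := C₀rat_nonneg 1
  have hK0 : 0 ≤ K := by rw [hK]; positivity
  obtain ⟨N₁, hN₁⟩ := exists_nat_gt ((K + |Real.log C|) / κ)
  obtain ⟨r', hden, _hne, hlt⟩ := hρ (max q₀ (max N₁ 1))
  have hq1n : 1 ≤ r'.den := r'.den_pos
  have hq1 : (1 : ℝ) ≤ r'.den := by exact_mod_cast hq1n
  have hq0 : (0 : ℝ) < r'.den := by linarith
  have hqq₀ : q₀ ≤ r'.den := le_trans (le_max_left _ _) hden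
  have hqN₁ : (N₁ : ℝ) ≤ r'.den := by
    exact_mod_cast le_trans ((le_max_left _ _).trans (le_max_right q₀ _)) hden
  -- the approximant is in the piece's regime: `exp(−q⁸) ≤ exp(−q)`
  have hq8 : (r'.den : ℝ) ≤ (r'.den : ℝ) ^ 8 := le_self_pow₀ hq1 (by norm_num)
  have hlt' : |ρ - r'| < Real.exp (-(r'.den : ℝ)) :=
    hlt.trans_le (Real.exp_le_exp.2 (by linarith))
  obtain ⟨Q, ξ, hQirr, hQdeg, hξ, hdeg, hM, hclose⟩ := hmain r' hqq₀ hlt'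
  -- sizes of the moving zero: `1 ≤ n ≤ c₁' q²`, `log M ≤ c₂' q³`
  set n : ℕ := Q.natDegree with hn
  have hn1 : 1 ≤ n := hQdeg
  have hdeg' : (n : ℝ) ≤ c₁' * (r'.den : ℝ) ^ 2 :=
    hdeg.trans (mul_le_mul_of_nonneg_right (le_max_left _ _) (by positivity))
  have hlogq : Real.log ((r'.den : ℝ) + 1) ≤ r'.den := by
    have := Real.log_le_sub_one_of_pos (show (0 : ℝ) < r'.den + 1 by linarith); linarith
  have hlogq0 : 0 ≤ Real.log ((r'.den : ℝ) + 1) := Real.log_nonneg (by linarith)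
  have hM' : Real.log (Q.map (Int.castRingHom ℂ)).mahlerMeasure ≤ c₂' * (r'.den : ℝ) ^ 3 := by
    calc Real.log (Q.map (Int.castRingHom ℂ)).mahlerMeasure
        ≤ c₂ * (r'.den : ℝ) ^ 2 * Real.log ((r'.den : ℝ) + 1) := hM
      _ ≤ c₂' * (r'.den : ℝ) ^ 2 * Real.log ((r'.den : ℝ) + 1) :=
          mul_le_mul_of_nonneg_right (mul_le_mul_of_nonneg_right (le_max_left _ _) (by positivity)) hlogq0
      _ ≤ c₂' * (r'.den : ℝ) ^ 2 * r'.den := mul_le_mul_of_nonneg_left hlogq (by positivity)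
      _ = c₂' * (r'.den : ℝ) ^ 3 := by ring
  -- the height parameter `Y` of the measure
  have hq2 : (r'.den : ℝ) ^ 2 ≤ (r'.den : ℝ) ^ 3 := pow_le_pow_right₀ hq1 (by norm_num)
  have hq3 : (1 : ℝ) ≤ (r'.den : ℝ) ^ 3 := one_le_pow₀ hq1
  set Y : ℝ := max ((c₁' + c₂') * (r'.den : ℝ) ^ 3) (Real.log 16) with hYdef
  have hY16 : Real.log 16 ≤ Y := le_max_right _ _
  have hMY : Real.log (Q.map (Int.castRingHom ℂ)).mahlerMeasure ≤ Y :=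
    hM'.trans ((by nlinarith : c₂' * (r'.den : ℝ) ^ 3 ≤ (c₁' + c₂') * (r'.den : ℝ) ^ 3).trans
      (le_max_left _ _))
  have hnY : (n : ℝ) ≤ Y := by
    have : c₁' * (r'.den : ℝ) ^ 2 ≤ (c₁' + c₂') * (r'.den : ℝ) ^ 3 := by nlinarith
    exact hdeg'.trans (this.trans (le_max_left _ _))
  have hYle : Y ≤ (c₁' + c₂' + 3) * (r'.den : ℝ) ^ 3 := by
    rcases le_total ((c₁' + c₂') * (r'.den : ℝ) ^ 3) (Real.log 16) with h | h
    · rw [hYdef, max_eq_right h]; nlinarith [log_sixteen_lt_three]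
    · rw [hYdef, max_eq_left h]; nlinarith
  have hY0 : 0 ≤ Y := le_trans (by linarith [one_lt_log_sixteen]) hY16
  -- the approximation measure of `e = e^1` at `ξ`
  have hlow := hX 1 one_ne_zero Q hQirr hQdeg ξ hξ Y hY16 hMY
  rw [Rat.cast_one] at hlow
  set A : ℝ := C₀rat 1 * (n : ℝ) ^ 2 * Y * (Real.log Y + Real.log n) ^ 2 / Real.log Y ^ 2 with hA
  have hA1 : A ≤ C₀rat 1 * (4 * ((n : ℝ) ^ 2 * Y)) := by
    have := mul_le_mul_of_nonneg_left (factor_le hn1 hnY hY16) hC0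
    calc A = C₀rat 1 * ((n : ℝ) ^ 2 * Y * (Real.log Y + Real.log n) ^ 2 / Real.log Y ^ 2) := by
          rw [hA]; ring
      _ ≤ _ := this
  have hn2 : (n : ℝ) ^ 2 ≤ (c₁' * (r'.den : ℝ) ^ 2) ^ 2 := pow_le_pow_left₀ (by positivity) hdeg' 2
  have hAK : A ≤ K * (r'.den : ℝ) ^ 7 := by
    have h1 : (n : ℝ) ^ 2 * Y ≤ (c₁' * (r'.den : ℝ) ^ 2) ^ 2 * ((c₁' + c₂' + 3) * (r'.den : ℝ) ^ 3) :=
      mul_le_mul hn2 hYle hY0 (by positivity)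
    have h2 := mul_le_mul_of_nonneg_left h1 (show 0 ≤ C₀rat 1 * 4 by positivity)
    calc A ≤ C₀rat 1 * (4 * ((n : ℝ) ^ 2 * Y)) := hA1
      _ = C₀rat 1 * 4 * ((n : ℝ) ^ 2 * Y) := by ring
      _ ≤ C₀rat 1 * 4 * ((c₁' * (r'.den : ℝ) ^ 2) ^ 2 * ((c₁' + c₂' + 3) * (r'.den : ℝ) ^ 3)) := h2
      _ = K * (r'.den : ℝ) ^ 7 := by rw [hK]; ring
  -- the moving zero is too close: `‖e − ξ‖ ≤ C |ρ − r'|^κ < C exp(−κ q⁸)`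
  have hpow : |ρ - r'| ^ κ < Real.exp (-(r'.den : ℝ) ^ 8) ^ κ :=
    Real.rpow_lt_rpow (abs_nonneg _) hlt hκ
  have hexpκ : Real.exp (-(r'.den : ℝ) ^ 8) ^ κ = Real.exp (-(κ * (r'.den : ℝ) ^ 8)) := by
    rw [← Real.exp_mul]; ring_nf
  have hup : ‖cexp 1 - ξ‖ < C * Real.exp (-(κ * (r'.den : ℝ) ^ 8)) := by
    rw [← hexpκ]
    exact hclose.trans_lt (mul_lt_mul_of_pos_left hpow hC)
  -- the clash
  have hchain : Real.exp (-A) < C * Real.exp (-(κ * (r'.den : ℝ) ^ 8)) := hlow.trans_lt hup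
  have hlog := Real.log_lt_log (Real.exp_pos _) hchain
  rw [Real.log_exp, Real.log_mul hC.ne' (Real.exp_pos _).ne', Real.log_exp] at hlog
  have hlogC : Real.log C ≤ |Real.log C| := le_abs_self _
  have hq7 : (1 : ℝ) ≤ (r'.den : ℝ) ^ 7 := one_le_pow₀ hq1
  have hlogC7 : |Real.log C| ≤ |Real.log C| * (r'.den : ℝ) ^ 7 :=
    le_mul_of_one_le_right (abs_nonneg _) hq7
  have h7 : κ * (r'.den : ℝ) ^ 8 < (K + |Real.log C|) * (r'.den : ℝ) ^ 7 := by
    have h7a : κ * (r'.den : ℝ) ^ 8 < A + Real.log C := by linarith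
    have h7b : A + Real.log C ≤ K * (r'.den : ℝ) ^ 7 + |Real.log C| * (r'.den : ℝ) ^ 7 := by linarith
    linarith
  have hN₁' : K + |Real.log C| < κ * (N₁ : ℝ) := by
    have := (div_lt_iff₀ hκ).1 hN₁; linarith
  have h8 : (K + |Real.log C|) * (r'.den : ℝ) ^ 7 ≤ κ * (r'.den : ℝ) ^ 8 := by
    have hKq : K + |Real.log C| ≤ κ * (r'.den : ℝ) := by
      have := mul_le_mul_of_nonneg_left hqN₁ hκ.le; linarith
    calc (K + |Real.log C|) * (r'.den : ℝ) ^ 7 ≤ κ * (r'.den : ℝ) * (r'.den : ℝ) ^ 7 :=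
          mul_le_mul_of_nonneg_right hKq (by positivity)
      _ = κ * (r'.den : ℝ) ^ 8 := by ring
  linarith

/-- The `(1, ρ)` instance (the target cell's shape). -/
theorem four_le_polarDeg_one_of_movingZero (hLW : LWMeasure) (hX : ExplicitRatExpApprox) {ρ : ℝ}
    (hρ : LiouvilleOrder 8 ρ) (hMZ : MovingZeroApprox ρ) :
    ((2 + 2 : ℕ) : Cardinal) ≤ polarDeg ![(1 : ℝ), ρ] := by
  obtain ⟨h₁, h₂, h₃, h₄, h₅⟩ := mem_polarField_one ρ
  exact four_le_polarDeg_of_movingZero hLW hX hρ hMZ h₁ h₂ h₃ h₄ h₅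

/-- The swapped ordering `(ρ, 1)` — DERIVED (same polar field), not planted. -/
theorem four_le_polarDeg_swap_of_movingZero (hLW : LWMeasure) (hX : ExplicitRatExpApprox) {ρ : ℝ}
    (hρ : LiouvilleOrder 8 ρ) (hMZ : MovingZeroApprox ρ) :
    ((2 + 2 : ℕ) : Cardinal) ≤ polarDeg ![ρ, (1 : ℝ)] := by
  obtain ⟨h₁, h₂, h₃, h₄, h₅⟩ := mem_polarField_swap ρ
  exact four_le_polarDeg_of_movingZero hLW hX hρ hMZ h₁ h₂ h₃ h₄ h₅

/-! ## §4  The cells at `(1 | ρ)` below ultra -/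

section Cells

/-- **X(2)(1, ρ) from the two pieces:** `t(1, ρ) ≥ 4` for `ρ` of exponential order `8`, given T and M′. -/
theorem four_le_polarDeg_one_of_pieces (hLW : LWMeasure) (hX : ExplicitRatExpApprox) {ρ : ℝ}
    (hρ : LiouvilleOrder 8 ρ) (hT : IsolatedIntersection ρ) (hM : ApproxOfIsolated ρ) :
    ((2 + 2 : ℕ) : Cardinal) ≤ polarDeg ![(1 : ℝ), ρ] :=
  four_le_polarDeg_one_of_movingZero hLW hX hρ (movingZeroApprox_of hT hM)

/-- **X(2)(1, ρ), hyper-Liouville `ρ`** (the class of 1K's item 33363), given the piece. -/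
theorem four_le_polarDeg_one_hyper (hLW : LWMeasure) (hX : ExplicitRatExpApprox) {ρ : ℝ}
    (hρ : HyperLiouville ρ) (hMZ : MovingZeroApprox ρ) :
    ((2 + 2 : ℕ) : Cardinal) ≤ polarDeg ![(1 : ℝ), ρ] :=
  four_le_polarDeg_one_of_movingZero hLW hX (LiouvilleOrder.of_hyperLiouville hρ 8) hMZ

/-- … and every higher order (monotonicity). -/
theorem four_le_polarDeg_one_of_order_ge (hLW : LWMeasure) (hX : ExplicitRatExpApprox) {ρ : ℝ} {k : ℕ}
    (hk : 8 ≤ k) (hρ : LiouvilleOrder k ρ) (hMZ : MovingZeroApprox ρ) :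
    ((2 + 2 : ℕ) : Cardinal) ≤ polarDeg ![(1 : ℝ), ρ] :=
  four_le_polarDeg_one_of_movingZero hLW hX (hρ.mono hk) hMZ

/-- The same in the VERBATIM shape of the body of the 1B crux `KleinPolarSchanuel` (item 24622) at `m = 2`,
`r = (1, ρ)` (`polarDeg` unfolded). -/
theorem kleinPolarSchanuel_body_two_one (hLW : LWMeasure) (hX : ExplicitRatExpApprox) {ρ : ℝ}
    (hρ : LiouvilleOrder 8 ρ) (hMZ : MovingZeroApprox ρ) :
    ((2 + 2 : ℕ) : Cardinal) ≤ Algebra.trdeg ℚ ↥(IntermediateField.adjoin ℚ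
      (Set.range (Fin.append (fun j => ((![(1 : ℝ), ρ] j : ℝ) : ℂ)) (fun j => ((![(1 : ℝ), ρ] j : ℝ) : ℂ) * Complex.I)) ∪
        Set.range (Complex.exp ∘ Fin.append (fun j => ((![(1 : ℝ), ρ] j : ℝ) : ℂ))
          (fun j => ((![(1 : ℝ), ρ] j : ℝ) : ℂ) * Complex.I)))) :=
  four_le_polarDeg_one_of_movingZero hLW hX hρ hMZ

/-- `t(1, ρ) ≥ 3` (the weaker floor, for the SRL step instance). -/
theorem three_le_polarDeg_one (hLW : LWMeasure) (hX : ExplicitRatExpApprox) {ρ : ℝ}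
    (hρ : LiouvilleOrder 8 ρ) (hMZ : MovingZeroApprox ρ) :
    ((1 + 1 + 1 : ℕ) : Cardinal) ≤ polarDeg ![(1 : ℝ), ρ] :=
  (Nat.cast_le.2 (by norm_num)).trans (four_le_polarDeg_one_of_movingZero hLW hX hρ hMZ)

/-- **SRLAt (1 | ρ)** — the sharp relative Lindemann step of item 32406 AT `(1 | ρ)`. -/
theorem sharpRelativeLindemannAt_one (hLW : LWMeasure) (hX : ExplicitRatExpApprox) {ρ : ℝ}
    (hρ : LiouvilleOrder 8 ρ) (hMZ : MovingZeroApprox ρ) : SharpRelativeLindemannAt 1 ![(1 : ℝ), ρ] :=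
  fun _ _ _ => three_le_polarDeg_one hLW hX hρ hMZ

/-- **T0At (1 | ρ)** — the tame defect-zero step of item 32407 AT `(1 | ρ)`. -/
theorem tameDefectZeroAt_one (hLW : LWMeasure) (hX : ExplicitRatExpApprox) {ρ : ℝ}
    (hρ : LiouvilleOrder 8 ρ) (hMZ : MovingZeroApprox ρ) : TameDefectZeroAt 1 ![(1 : ℝ), ρ] :=
  fun _ _ _ _ => four_le_polarDeg_one_of_movingZero hLW hX hρ hMZ

/-- **W0At (1 | ρ)** — the wild sharp defect-zero step of item 32408 AT `(1 | ρ)`. -/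
theorem wildSharpDefectZeroAt_one (hLW : LWMeasure) (hX : ExplicitRatExpApprox) {ρ : ℝ}
    (hρ : LiouvilleOrder 8 ρ) (hMZ : MovingZeroApprox ρ) : WildSharpDefectZeroAt 1 ![(1 : ℝ), ρ] :=
  fun _ _ _ _ _ => four_le_polarDeg_one_of_movingZero hLW hX hρ hMZ

/-- **W0InitAt (1 | ρ)** — the init-form of the wild step AT `(1 | ρ)`. -/
theorem wildSharpDefectZeroInitAt_one (hLW : LWMeasure) (hX : ExplicitRatExpApprox) {ρ : ℝ}
    (hρ : LiouvilleOrder 8 ρ) (hMZ : MovingZeroApprox ρ) : WildSharpDefectZeroInitAt 1 ![(1 : ℝ), ρ] :=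
  fun _ _ _ _ _ => four_le_polarDeg_one_of_movingZero hLW hX hρ hMZ

/-- LIVE LINK (route 1K, item 33363 `HyperLiouvilleSchanuel`): its `n = 4` instance at `z = (1, ρ, i, iρ)` in the
item's verbatim binder shape, `ρ` hyper-Liouville, given the piece. -/
theorem hyperLiouvilleSchanuel_instance_one (hLW : LWMeasure) (hX : ExplicitRatExpApprox) {ρ : ℝ}
    (hρ : HyperLiouville ρ) (hMZ : MovingZeroApprox ρ) :
    LinearIndependent ℚ (Fin.append (fun j => ((![(1 : ℝ), ρ] j : ℝ) : ℂ))
        (fun j => ((![(1 : ℝ), ρ] j : ℝ) : ℂ) * Complex.I)) →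
      (∀ m : ℕ, ∃ h : Fin (2 + 2) → ℤ, h ≠ 0 ∧
        ‖∑ i, (h i : ℂ) * (Fin.append (fun j => ((![(1 : ℝ), ρ] j : ℝ) : ℂ))
          (fun j => ((![(1 : ℝ), ρ] j : ℝ) : ℂ) * Complex.I)) i‖ < Real.exp (-((1 + ∑ i, (|h i| : ℝ)) ^ m))) →
      ((2 + 2 : ℕ) : Cardinal) ≤ Algebra.trdeg ℚ ↥(IntermediateField.adjoin ℚ
        (Set.range (Fin.append (fun j => ((![(1 : ℝ), ρ] j : ℝ) : ℂ)) (fun j => ((![(1 : ℝ), ρ] j : ℝ) : ℂ) * Complex.I)) ∪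
          Set.range (Complex.exp ∘ Fin.append (fun j => ((![(1 : ℝ), ρ] j : ℝ) : ℂ))
            (fun j => ((![(1 : ℝ), ρ] j : ℝ) : ℂ) * Complex.I)))) :=
  fun _ _ => four_le_polarDeg_one_hyper hLW hX hρ hMZ

/-- LIVE LINK (route 1K, item 33364 `FiniteOrderLiouvilleSchanuel`): its `n = 4` instance at `z = (1, ρ, i, iρ)`,
`ρ` of exponential order `8` (hyper or NOT), given the piece. -/
theorem finiteOrderLiouvilleSchanuel_instance_one (hLW : LWMeasure) (hX : ExplicitRatExpApprox) {ρ : ℝ}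
    (hρ : LiouvilleOrder 8 ρ) (hMZ : MovingZeroApprox ρ) :
    LinearIndependent ℚ (Fin.append (fun j => ((![(1 : ℝ), ρ] j : ℝ) : ℂ))
        (fun j => ((![(1 : ℝ), ρ] j : ℝ) : ℂ) * Complex.I)) →
      (∀ ω : ℕ, ∃ h : Fin (2 + 2) → ℤ, h ≠ 0 ∧
        ‖∑ i, (h i : ℂ) * (Fin.append (fun j => ((![(1 : ℝ), ρ] j : ℝ) : ℂ))
          (fun j => ((![(1 : ℝ), ρ] j : ℝ) : ℂ) * Complex.I)) i‖ <
            1 / (1 + ∑ i, (|h i| : ℝ)) ^ ω) →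
      (¬ ∀ m : ℕ, ∃ h : Fin (2 + 2) → ℤ, h ≠ 0 ∧
        ‖∑ i, (h i : ℂ) * (Fin.append (fun j => ((![(1 : ℝ), ρ] j : ℝ) : ℂ))
          (fun j => ((![(1 : ℝ), ρ] j : ℝ) : ℂ) * Complex.I)) i‖ <
            Real.exp (-((1 + ∑ i, (|h i| : ℝ)) ^ m))) →
      ((2 + 2 : ℕ) : Cardinal) ≤ Algebra.trdeg ℚ ↥(IntermediateField.adjoin ℚ
        (Set.range (Fin.append (fun j => ((![(1 : ℝ), ρ] j : ℝ) : ℂ))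
            (fun j => ((![(1 : ℝ), ρ] j : ℝ) : ℂ) * Complex.I)) ∪
          Set.range (Complex.exp ∘ Fin.append (fun j => ((![(1 : ℝ), ρ] j : ℝ) : ℂ))
            (fun j => ((![(1 : ℝ), ρ] j : ℝ) : ℂ) * Complex.I)))) :=
  fun _ _ _ => four_le_polarDeg_one_of_movingZero hLW hX hρ hMZ

/-! ### Members -/

/-- The NAMED non-hyper member: `ρ_T = towerNumber 9` has exponential order `8` … -/
theorem liouvilleOrder_rhoT : LiouvilleOrder 8 (towerNumber 9) := liouvilleOrder_towerNumber 8

/-- … is NOT hyper-Liouville … -/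
theorem not_hyperLiouville_rhoT : ¬ HyperLiouville (towerNumber 9) := not_hyperLiouville_towerNumber (by norm_num)

/-- … hence NOT ultra-Liouville: `(1 | ρ_T)` is OUTSIDE the tree's `(1 | u)` cells (`u` ultra-Liouville). -/
theorem not_ultraLiouville_rhoT : ¬ UltraLiouville (towerNumber 9) :=
  fun h => not_hyperLiouville_rhoT h.hyperLiouville

/-- `(1, ρ_T)` is `ℚ`-free (tree: `linearIndependent_one_of_irrational`). -/
theorem linearIndependent_one_rhoT : LinearIndependent ℚ ![(1 : ℝ), towerNumber 9] :=
  linearIndependent_one_of_irrational (liouvilleOrder_rhoT.liouville (by norm_num)).irrational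

/-- **X(2) AT `(1, ρ_T)`** — a storey-two cell with a NON-hyper-Liouville (a fortiori non-ultra) ratio, given
the piece at `ρ_T`. -/
theorem four_le_polarDeg_one_rhoT (hLW : LWMeasure) (hX : ExplicitRatExpApprox)
    (hMZ : MovingZeroApprox (towerNumber 9)) :
    ((2 + 2 : ℕ) : Cardinal) ≤ polarDeg ![(1 : ℝ), towerNumber 9] :=
  four_le_polarDeg_one_of_movingZero hLW hX liouvilleOrder_rhoT hMZ

/-- **X(2) AT `(1, λ_H)`** — the hyper-Liouville member of 1K (`λ_H`), given the piece at `λ_H`. -/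
theorem four_le_polarDeg_one_lambdaH (hLW : LWMeasure) (hX : ExplicitRatExpApprox)
    (hMZ : MovingZeroApprox lambdaH) :
    ((2 + 2 : ℕ) : Cardinal) ≤ polarDeg ![(1 : ℝ), lambdaH] :=
  four_le_polarDeg_one_hyper hLW hX hyperLiouville_lambdaH hMZ

/-- COMPARISON: the tree's cell needs `UltraLiouville ρ`; ultra ⟹ hyper ⟹ order 8, so the new cell COVERS the
old class (given the piece) — and `ρ_T` shows the inclusion `order 8 ⊋ hyper ⊇ ultra` is strict. -/
theorem four_le_polarDeg_one_ultra' (hLW : LWMeasure) (hX : ExplicitRatExpApprox) {ρ : ℝ}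
    (hρ : UltraLiouville ρ) (hMZ : MovingZeroApprox ρ) :
    ((2 + 2 : ℕ) : Cardinal) ≤ polarDeg ![(1 : ℝ), ρ] :=
  four_le_polarDeg_one_hyper hLW hX hρ.hyperLiouville hMZ

/-- … whereas at ultra-Liouville `ρ` the tree decides the cell WITHOUT the piece (recorded for the census). -/
private theorem four_le_polarDeg_one_ultra_tree (hLW : LWMeasure) {ρ : ℝ} (hρ : UltraLiouville ρ) :
    ((2 + 2 : ℕ) : Cardinal) ≤ polarDeg ![(1 : ℝ), ρ] :=
  four_le_polarDeg_one_ultra hLW hρ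

end Cells

end Summit.Schanuel.Schanuel.Theorems.RootDecomp1BMovingZero

end
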